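import Summits.BirchSwinnertonDyer.BirchSwinnertonDyer.Theorems.AdditiveKolyvaginRoadRamifiedHabitatPStarTwistSign
import Literature.NumberTheory.EllipticCurves.QuadraticTwistKroneckerRootNumberProofs
import HarnessLib

/-!
# Route `AdditiveKolyvaginRoad`, crux KS′ `LevelKolyvaginSystemsAdditive` (stmt-BirchSwinnertonDyer-21396), card `ramified-toric-habitat` —
# part 3: the RAMIFIED-HABITAT SIGN LAW `w(E)·w(E^{(d_{K′})}) = +1 ⟺ e ∤ p − 1` (types II, III, IV), in the tree's currency

Cell `pub/bsd-wall`, width seat `bsd-wall-akr-p2x-w2` g11; `--supports stmt-BirchSwinnertonDyer-21396` (helper). THEOREMS ONLY; no definition,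
no named fact, no `sorry`. BSD is not proved by any of this; KS′/KPA′ stay OPEN at `p² ∣ N`.

The card's FIRST LEMMA (`Cruxes/LevelKolyvaginSystemsAdditive/RamifiedHabitatKuriharaSlotSketch.lean` §1 `RamifiedToricHabitat.SignLawSupercuspidal`,
`…SignLawPrincipalSeries`): for `E/ℚ` additive potentially good at `p ≥ 5` with semistability defect `e`, and the `p`-RAMIFIED habitat
`K′` (imaginary quadratic, `p ∣ d_{K′}`, every other bad prime split), `w(E)·w(E^{(d_{K′})}) = +1` if `e ∤ p − 1` (supercuspidal) and
`= −1` if `e ∣ p − 1` (principal series). Here it is PROVED, CONDITIONAL on the Modularity Theorem (`exists_isNewformOf`) and on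
Kellock–Dokchitser's Remark 2.2 at `p` for `E` and `E^{(p*)}` (the named fact `atkinLehnerEigenvalueAt_eq_localRootNumberAt`), for
`E` semistable away from `p` (`N = M·p²`, `M` squarefree), `d_{K′}` ODD, and Kodaira types II, III, IV at `p`
(`ord_p Δ_min = a ∈ {2,3,4}`; `e := 12/gcd(12, a) ∈ {6,4,3}` — Serre's reading of the defect, which the tree's `semistabilityDefectAt`
records but does not prove; the hypotheses are therefore phrased by `a`, exactly as Rohrlich's `localRootNumber` is):

* §5 `rootNumber_mul_rootNumber_ramifiedTwist` — for `d = p*·d'` (`d' ≡ 1 (4)` squarefree, `(d', N) = 1`, `d < 0`, every `q ∣ M` split in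
  `ℚ(√d)`): `w(E)·w(E^{(d)}) = −(−1/p)` (`e = 4`), `= −(−3/p)` (`e ∈ {3, 6}`). Mechanism: `E^{(d)} = (E^{(p*)})^{(d')}`, the coprime law
  `w = χ_{d'}(−N)·w(E^{(p*)})` (tree, Murty–Murty Ch. 6 §1), part 2's `w(E)w(E^{(p*)}) = (M/p)·W_pW_p'`, and the splitting hypothesis
  in the form `(M/|d'|) = (M/p)`, `(−1/|d'|) = −(−1/p)`.
* §6 `…_eq_one_of_not_dvd` / `…_eq_neg_one_of_dvd` — the two halves of the dichotomy: `+1` if `e ∤ p − 1`, `−1` if `e ∣ p − 1`;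
  `…_discr_eq_one_of_not_dvd` / `…_discr_eq_neg_one_of_dvd` — the same with the habitat given as a FIELD `K′`
  (`IsImaginaryQuadratic K′`, `d_{K′}` odd, `p ∣ d_{K′}`, `(d_{K′}/q) = 1` at odd `q ∣ M`, `d_{K′} ≡ 1 (8)` if `2 ∣ M`) — the binders of the
  sketch's `SignLawSupercuspidal` with `OtherBadPrimesSplit`, restricted as above.

DATUM recorded with the card (evidence #41 on the crux item): the sketch's `SignLawPrincipalSeries` also admits additive potentially
MULTIPLICATIVE `p` (defect `2 ∣ p − 1`), where the sign depends on `d` (`E = 11a1^{(−11)}`, `K′ = ℚ(√−11)` vs `ℚ(√−22)`); the theorems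
below carry the potentially-good hypothesis (`3·ord_p c₄ ≥ ord_p Δ`) and are not affected. Starred types (`a ∈ {8,9,10}`), other additive
primes `≥ 5` of `E`, and even `d_{K′}` are not treated (part 1's low branch; `M` squarefree; `d' ≡ 1 (4)`).

References: [cite: MurtyMurty1997, Ch. 6 §1] [cite: Rohrlich1993Compositio, Prop. 2(iv)] [cite: KellockDokchitser2023, Rem. 2.2]
[cite: Knapp1993, Thm. 9.27].
-/

set_option autoImplicit false
set_option linter.dupNamespace false

noncomputable section

open scoped Classical MatrixGroups

open CongruenceSubgroup IsDedekindDomain IsDedekindDomain.HeightOneSpectrum NumberField Rat.HeightOneSpectrum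
  WeierstrassCurve Literature.NumberTheory.EllipticCurves Literature.NumberTheory.EllipticCurves.ModularForms
  IsDiscreteValuationRing

namespace Summit.BirchSwinnertonDyer.BirchSwinnertonDyer.Theorems.AdditiveKoly.RamifiedHabitat

/-! ## §5 The habitat sign law: `w(E)·w(E^{(d)})` for `d = p*·d'` with every prime of `M` split in `ℚ(√d)` -/

section SignLaw

open scoped NumberTheorySymbols

variable {p : ℕ} [Fact p.Prime]

/-- At an odd prime `q` SPLIT in `ℚ(√d)`, `d = p*·d'`, i.e. `(d/q) = 1`: `(q / |d'|) = (q/p)`. Indeed `(q/|d'|) = (d'/q)` for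
`d' ≡ 1 (mod 4)` (reciprocity, the tree's `jacobiSym_natAbs_eq_of_emod_four_eq_one`), `(p*/q)(d'/q) = 1` with `(p*/q)² = 1`, and
`(p*/q) = (q/p)` (`legendreSym_pStar`). [folklore] -/
theorem jacobiSym_natAbs_eq_legendreSym_of_split_odd (hp2 : p ≠ 2) {d' : ℤ} (hd'4 : d' % 4 = 1) {q : ℕ} [Fact q.Prime]
    (hq2 : q ≠ 2) (hsplit : J((-1 : ℤ) ^ (p / 2) * p * d' | q) = 1) :
    J((q : ℤ) | d'.natAbs) = legendreSym p q := by
  have hqodd : Odd q := (Nat.Prime.eq_two_or_odd' (Fact.out : q.Prime)).resolve_left hq2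
  rw [Literature.NumberTheory.QuadraticFields.jacobiSym_natAbs_eq_of_emod_four_eq_one hd'4 hqodd, ← legendreSym_pStar hp2 hq2, jacobiSym.legendreSym.to_jacobiSym]
  rw [jacobiSym.mul_left] at hsplit
  set A := J((-1 : ℤ) ^ (p / 2) * p | q)
  set B := J(d' | q)
  haveI : NeZero q := ⟨(Fact.out : q.Prime).ne_zero⟩
  have hA0 : A ≠ 0 := fun h ↦ by rw [h, zero_mul] at hsplit; exact zero_ne_one hsplit
  have hA2 : A * A = 1 := by
    rw [← sq]
    exact jacobiSym.sq_one (by by_contra h; exact hA0 (jacobiSym.eq_zero_iff_not_coprime.mpr h))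
  calc B = A * (A * B) := by rw [← mul_assoc, hA2, one_mul]
    _ = A := by rw [hsplit, mul_one]

/-- At `q = 2` SPLIT in `ℚ(√d)`, `d = p*·d' ≡ 1 (mod 8)`: `(2 / |d'|) = (2/p)`. Indeed `(2/|d'|) = χ₈(|d'|) = χ₈(d')`
(`d'` odd, `χ₈` even), `d' ≡ p* (mod 8)` (as `p*² ≡ 1`), and `χ₈(p*) = χ₈(p) = (2/p)`. [folklore] -/
theorem jacobiSym_two_natAbs_eq_legendreSym_of_split (hp2 : p ≠ 2) {d' : ℤ} (hd'4 : d' % 4 = 1)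
    (hsplit : ((-1 : ℤ) ^ (p / 2) * p * d') % 8 = 1) :
    J((2 : ℕ) | d'.natAbs) = legendreSym p 2 := by
  have hodd : Odd d'.natAbs := Int.natAbs_odd.mpr (Int.odd_iff.mpr (by omega))
  rw [Nat.cast_ofNat, jacobiSym.at_two hodd, legendreSym.at_two hp2]
  -- move to `ZMod 8`
  have key : ∀ x y : ZMod 8, x * y = 1 → ZMod.χ₈ y = ZMod.χ₈ x := by decide
  have heven : ∀ x : ZMod 8, ZMod.χ₈ (-x) = ZMod.χ₈ x := by decide
  have h1 : ((((-1 : ℤ) ^ (p / 2) * p * d' : ℤ)) : ZMod 8) = 1 := by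
    have h8 : ((-1 : ℤ) ^ (p / 2) * p * d') = 8 * (((-1 : ℤ) ^ (p / 2) * p * d') / 8) + 1 := by omega
    rw [h8, Int.cast_add, Int.cast_mul, Int.cast_one, show ((8 : ℤ) : ZMod 8) = 0 by decide, zero_mul, zero_add]
  push_cast at h1
  have h2 : ZMod.χ₈ ((d' : ℤ) : ZMod 8) = ZMod.χ₈ (((-1 : ℤ) : ZMod 8) ^ (p / 2) * (p : ZMod 8)) :=
    key _ _ (by rw [Int.cast_neg, Int.cast_one] ; exact h1)
  have h3 : ZMod.χ₈ (((-1 : ℤ) : ZMod 8) ^ (p / 2) * (p : ZMod 8)) = ZMod.χ₈ (p : ZMod 8) := by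
    rcases neg_one_pow_eq_or (ZMod 8) (p / 2) with h | h
    · rw [Int.cast_neg, Int.cast_one, h, one_mul]
    · rw [Int.cast_neg, Int.cast_one, h, neg_one_mul, heven]
  have h4 : (d'.natAbs : ZMod 8) = (d' : ZMod 8) ∨ (d'.natAbs : ZMod 8) = -(d' : ZMod 8) := by
    rcases Int.natAbs_eq d' with h | h
    · left
      conv_rhs => rw [h]
      rw [Int.cast_natCast]
    · right
      have := congrArg (fun z : ℤ ↦ (z : ZMod 8)) h
      simp only [Int.cast_neg, Int.cast_natCast] at this
      rw [this, neg_neg]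
  rcases h4 with h4 | h4
  · rw [h4, h2, h3]
  · rw [h4, heven, h2, h3]

/-- `(M / |d'|) = (M/p)` for squarefree `M` all of whose primes split in `ℚ(√d)`, `d = p*·d'` (prime by prime, the two lemmas above;
`(·/p)` and `(· / |d'|)` are multiplicative). [folklore] -/
theorem jacobiSym_natAbs_eq_legendreSym_of_split (hp2 : p ≠ 2) {d' : ℤ} (hd'4 : d' % 4 = 1) {M : ℕ} (hM : Squarefree M)
    (hodd : ∀ q ∈ M.primeFactors, q ≠ 2 → J((-1 : ℤ) ^ (p / 2) * p * d' | q) = 1)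
    (htwo : 2 ∣ M → ((-1 : ℤ) ^ (p / 2) * p * d') % 8 = 1) :
    J((M : ℤ) | d'.natAbs) = legendreSym p M := by
  -- both sides are multiplicative in `M = ∏_{q ∣ M} q`
  let φ : ℤ →* ℤ :=
    { toFun := fun a ↦ jacobiSym a d'.natAbs
      map_one' := jacobiSym.one_left _
      map_mul' := fun a b ↦ jacobiSym.mul_left a b _ }
  have hφ : ∀ a : ℤ, φ a = J(a | d'.natAbs) := fun _ ↦ rfl
  conv_lhs => rw [← Nat.prod_primeFactors_of_squarefree hM, Nat.cast_prod, ← hφ, map_prod]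
  conv_rhs => rw [← Nat.prod_primeFactors_of_squarefree hM, Nat.cast_prod, ← legendreSym.hom_apply, map_prod]
  refine Finset.prod_congr rfl fun q hq ↦ ?_
  rw [hφ, legendreSym.hom_apply]
  haveI := Fact.mk (Nat.prime_of_mem_primeFactors hq)
  by_cases hq2 : q = 2
  · subst hq2
    exact jacobiSym_two_natAbs_eq_legendreSym_of_split hp2 hd'4 (htwo (Nat.dvd_of_mem_primeFactors hq))
  · exact jacobiSym_natAbs_eq_legendreSym_of_split_odd hp2 hd'4 hq2 (hodd q hq hq2)

/-- `(−1 / |d'|) = −(−1/p)` when `d = p*·d' < 0` and `d' ≡ 1 (mod 4)`: `(−1/|d'|) = χ₄(|d'|) = sign d' = −sign p* = −χ₄(p)`.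
[folklore] -/
theorem jacobiSym_neg_one_natAbs_eq_of_neg (hp2 : p ≠ 2) {d' : ℤ} (hd'4 : d' % 4 = 1)
    (hneg : (-1 : ℤ) ^ (p / 2) * p * d' < 0) : J(-1 | d'.natAbs) = -ZMod.χ₄ p := by
  have hodd : Odd d'.natAbs := Int.natAbs_odd.mpr (Int.odd_iff.mpr (by omega))
  rw [jacobiSym.at_neg_one hodd, ZMod.χ₄_nat_eq_if_mod_four, ZMod.χ₄_nat_eq_if_mod_four]
  have hp' := (Nat.Prime.eq_two_or_odd (Fact.out : p.Prime)).resolve_left hp2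
  have hp0 : (0 : ℤ) < p := by exact_mod_cast (Fact.out : p.Prime).pos
  rcases Nat.odd_mod_four_iff.mp hp' with hp4 | hp4
  · rw [ZMod.neg_one_pow_div_two_of_one_mod_four hp4, one_mul] at hneg
    have hd'neg : d' < 0 := by
      by_contra h; push Not at h; exact absurd hneg (not_lt.mpr (mul_nonneg hp0.le h))
    have h1 : (d'.natAbs : ℤ) = -d' := Int.ofNat_natAbs_of_nonpos hd'neg.le
    have h2 : d'.natAbs % 4 = 3 := by omega
    have h3 : d'.natAbs % 2 = 1 := by omega
    simp [h2, h3, hp4, show p % 2 = 1 from hp']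
  · rw [ZMod.neg_one_pow_div_two_of_three_mod_four hp4] at hneg
    have hd'pos : 0 < d' := by
      by_contra h; push Not at h
      exact absurd hneg (not_lt.mpr (by nlinarith))
    have h1 : (d'.natAbs : ℤ) = d' := Int.natAbs_of_nonneg hd'pos.le
    have h2 : d'.natAbs % 4 = 1 := by omega
    have h3 : d'.natAbs % 2 = 1 := by omega
    simp [h2, h3, hp4, show p % 2 = 1 from hp']

/-- **THE RAMIFIED-HABITAT SIGN RATIO.** `W/ℚ` elliptic of conductor `N = M·p²` (`p ≥ 5`, `M` squarefree, `p ∤ M`), minimal model at `p`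
with `ord_p Δ = a ∈ {2,3,4}`, `ord_p c₄ > 0`, `3 ord_p c₄ ≥ ord_p Δ` (additive potentially good, types II/III/IV, `e = 6, 4, 3`);
`d = p*·d'` with `d' ≡ 1 (mod 4)` squarefree and prime to `N`, `d < 0`, and EVERY PRIME `q ∣ M` SPLIT in `ℚ(√d)` (`(d/q) = 1` for odd
`q`, `d ≡ 1 (mod 8)` if `q = 2`) — the card's habitat `K′ = ℚ(√d)`: imaginary quadratic, `p` RAMIFIED, the other bad primes split.
ASSUMING the Modularity Theorem and Kellock–Dokchitser's Rem. 2.2 for `W`, `W^{(p*)}` (named facts):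
`w(W)·w(W^{(d)}) = −(−1/p)` if `e = 4` and `= −(−3/p)` if `e ∈ {3, 6}`.
Proof: `W^{(d)} = (W^{(p*)})^{(d')}`, the coprime twist law `w((W^{(p*)})^{(d')}) = (−1/|d'|)(N/|d'|)·w(W^{(p*)})` (tree, Murty–Murty
Ch. 6 §1), §4, and `(N/|d'|) = (M/|d'|) = (M/p)`, `(−1/|d'|) = −(−1/p)` (the lemmas above), `(M/p)² = (−1/p)² = 1`.
[cite: MurtyMurty1997, Ch. 6 §1] [cite: Rohrlich1993Compositio, Prop. 2(iv)] [cite: KellockDokchitser2023, Rem. 2.2] -/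
theorem rootNumber_mul_rootNumber_ramifiedTwist (W : WeierstrassCurve ℚ) [W.IsElliptic] (hmod : exists_isNewformOf)
    (hF1 : W.atkinLehnerEigenvalueAt_eq_localRootNumberAt)
    (hF1' : (W.quadraticTwist (((-1 : ℤ) ^ (p / 2) * p : ℤ) : ℚ)).atkinLehnerEigenvalueAt_eq_localRootNumberAt)
    (hp5 : 5 ≤ p) {M : ℕ} (hN : W.conductorNorm ℤ = M * p ^ 2) (hM : Squarefree M) (hpM : ¬ p ∣ M) {a : ℕ}
    (hΔ : addVal ℤ_[p] (((W.baseChange ℚ_[p]).minimal ℤ_[p]).integralModel ℤ_[p]).Δ = a)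
    (ha : a = 2 ∨ a = 3 ∨ a = 4)
    (hc₄ : addVal ℤ_[p] (((W.baseChange ℚ_[p]).minimal ℤ_[p]).integralModel ℤ_[p]).c₄ ≠ 0)
    (hj : ¬ 3 * addVal ℤ_[p] (((W.baseChange ℚ_[p]).minimal ℤ_[p]).integralModel ℤ_[p]).c₄ <
      addVal ℤ_[p] (((W.baseChange ℚ_[p]).minimal ℤ_[p]).integralModel ℤ_[p]).Δ)
    {d' : ℤ} (hd'4 : d' % 4 = 1) (hd'sq : Squarefree d') (hgcd : Int.gcd d' (W.conductorNorm ℤ) = 1)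
    (hneg : (-1 : ℤ) ^ (p / 2) * p * d' < 0)
    (hodd : ∀ q ∈ M.primeFactors, q ≠ 2 → J((-1 : ℤ) ^ (p / 2) * p * d' | q) = 1)
    (htwo : 2 ∣ M → ((-1 : ℤ) ^ (p / 2) * p * d') % 8 = 1) :
    W.rootNumber * (W.quadraticTwist (((-1 : ℤ) ^ (p / 2) * p * d' : ℤ) : ℚ)).rootNumber =
      if a = 3 then -ZMod.χ₄ p else -(if p % 3 = 1 then 1 else -1) := by
  have hp : p.Prime := Fact.out
  have hp2 : p ≠ 2 := by omega
  have hdZ0 : ((-1 : ℤ) ^ (p / 2) * p : ℤ) ≠ 0 :=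
    mul_ne_zero (pow_ne_zero _ (by norm_num)) (by exact_mod_cast hp.ne_zero)
  have hd0 : (((((-1 : ℤ) ^ (p / 2) * p : ℤ)) : ℚ)) ≠ 0 := by exact_mod_cast hdZ0
  haveI hE' : (W.quadraticTwist (((-1 : ℤ) ^ (p / 2) * p : ℤ) : ℚ)).IsElliptic := W.isElliptic_quadraticTwist hd0
  -- §4 and the conductor of `W^{(p*)}`
  have hA := rootNumber_mul_rootNumber_pStarTwist W hmod hF1 hF1' hp5 hN hM hpM hΔ ha hc₄ hj
  obtain ⟨hadd, hadd', -⟩ := localRootNumber_mul_pStarTwist_padic W hp5 hΔ ha hc₄ hj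
  have hN' : (W.quadraticTwist (((-1 : ℤ) ^ (p / 2) * p : ℤ) : ℚ)).conductorNorm ℤ = M * p ^ 2 :=
    (conductorNorm_pStarTwist_eq W hp5 hadd hadd').trans hN
  -- the coprime twist law for `d'` on `W^{(p*)}`
  have hgcd' : Int.gcd d' ((W.quadraticTwist (((-1 : ℤ) ^ (p / 2) * p : ℤ) : ℚ)).conductorNorm ℤ) = 1 := by
    rw [hN', ← hN]; exact hgcd
  have hB := ((W.quadraticTwist (((-1 : ℤ) ^ (p / 2) * p : ℤ) : ℚ)).rootNumber_quadraticTwist_of_emod_four_eq_one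
    hmod hd'4 hd'sq hgcd').1
  rw [quadraticTwist_quadraticTwist, hN'] at hB
  have hcast : ((((-1 : ℤ) ^ (p / 2) * p : ℤ) : ℚ)) * (d' : ℚ) = (((-1 : ℤ) ^ (p / 2) * p * d' : ℤ) : ℚ) := by push_cast; ring
  rw [hcast] at hB
  -- the Jacobi symbols
  have hNe0 : NeZero d'.natAbs := ⟨Int.natAbs_ne_zero.mpr (by rintro rfl; norm_num at hd'4)⟩
  have hJM : J(((M * p ^ 2 : ℕ) : ℤ) | d'.natAbs) = legendreSym p M := by
    rw [Nat.cast_mul, jacobiSym.mul_left, jacobiSym_natAbs_eq_legendreSym_of_split hp2 hd'4 hM hodd htwo, Nat.cast_pow,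
      jacobiSym.sq_one', mul_one]
    -- `gcd(p, d') = 1` since `p ∣ N` and `gcd(d', N) = 1`
    rw [Int.gcd_natCast_natCast]
    have h1 : Nat.Coprime d'.natAbs (W.conductorNorm ℤ) := by
      have := hgcd; unfold Int.gcd at this; simpa using this
    have hpN : p ∣ W.conductorNorm ℤ := by rw [hN]; exact ⟨M * p, by ring⟩
    exact (Nat.Coprime.coprime_dvd_right hpN h1).symm
  have hJ1 := jacobiSym_neg_one_natAbs_eq_of_neg hp2 hd'4 hneg
  -- `(M/p)² = 1`, `χ₄(p)² = 1`
  have hM2 : legendreSym p M * legendreSym p M = 1 := by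
    rw [← sq]
    refine legendreSym.sq_one p ?_
    rw [Int.cast_natCast, ne_eq, ZMod.natCast_eq_zero_iff]
    exact hpM
  have hχ₄ : ZMod.χ₄ p * ZMod.χ₄ p = 1 := by
    have hp' := (Nat.Prime.eq_two_or_odd hp).resolve_left hp2
    rw [ZMod.χ₄_nat_eq_if_mod_four]
    have : p % 4 = 1 ∨ p % 4 = 3 := by omega
    have h2' : p % 2 ≠ 0 := by omega
    rcases this with h | h <;> simp [h, h2']
  -- assemble
  calc W.rootNumber * (W.quadraticTwist (((-1 : ℤ) ^ (p / 2) * p * d' : ℤ) : ℚ)).rootNumber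
      = J(-1 | d'.natAbs) * J(((M * p ^ 2 : ℕ) : ℤ) | d'.natAbs) *
          (W.rootNumber * (W.quadraticTwist (((-1 : ℤ) ^ (p / 2) * p : ℤ) : ℚ)).rootNumber) := by rw [hB]; ring
    _ = -ZMod.χ₄ p * legendreSym p M *
          (legendreSym p M * (if a = 3 then 1 else ZMod.χ₄ p * (if p % 3 = 1 then 1 else -1))) := by rw [hJ1, hJM, hA]
    _ = if a = 3 then -ZMod.χ₄ p else -(if p % 3 = 1 then 1 else -1) := by
          split_ifs
          · linear_combination (-(ZMod.χ₄ ↑p)) * hM2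
          · linear_combination (-(ZMod.χ₄ ↑p * ZMod.χ₄ ↑p)) * hM2 - hχ₄
          · linear_combination (ZMod.χ₄ ↑p * ZMod.χ₄ ↑p) * hM2 + hχ₄

/-! ## §6 The dichotomy `e ∤ p − 1` / `e ∣ p − 1`, and the habitat as a field -/

/-- **SUPERCUSPIDAL HALF (`e ∤ p − 1` ⟹ sign `+1`).** With the data of `rootNumber_mul_rootNumber_ramifiedTwist` and
`e := 12/gcd(12, a)` (`= 6, 4, 3` for `a = 2, 3, 4`): if `e ∤ p − 1` then `w(E)·w(E^{(d)}) = +1` — the sketch's `SignLawSupercuspidal`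
on types II/III/IV, semistable-away-from-`p`, odd `d`; conditional on {hmod, F1 at `p`}. (`e = 4 ∤ p−1 ⟺ p ≡ 3 (4) ⟺ (−1/p) = −1`;
`e ∈ {3,6}`, `e ∤ p−1 ⟺ p ≡ 2 (3) ⟺ (−3/p) = −1`.) [cite: Rohrlich1993Compositio, Prop. 2(iv)] [cite: KellockDokchitser2023, Rem. 2.2] -/
theorem rootNumber_mul_rootNumber_ramifiedTwist_eq_one_of_not_dvd (W : WeierstrassCurve ℚ) [W.IsElliptic]
    (hmod : exists_isNewformOf) (hF1 : W.atkinLehnerEigenvalueAt_eq_localRootNumberAt)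
    (hF1' : (W.quadraticTwist (((-1 : ℤ) ^ (p / 2) * p : ℤ) : ℚ)).atkinLehnerEigenvalueAt_eq_localRootNumberAt)
    (hp5 : 5 ≤ p) {M : ℕ} (hN : W.conductorNorm ℤ = M * p ^ 2) (hM : Squarefree M) (hpM : ¬ p ∣ M) {a : ℕ}
    (hΔ : addVal ℤ_[p] (((W.baseChange ℚ_[p]).minimal ℤ_[p]).integralModel ℤ_[p]).Δ = a)
    (ha : a = 2 ∨ a = 3 ∨ a = 4)
    (hc₄ : addVal ℤ_[p] (((W.baseChange ℚ_[p]).minimal ℤ_[p]).integralModel ℤ_[p]).c₄ ≠ 0)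
    (hj : ¬ 3 * addVal ℤ_[p] (((W.baseChange ℚ_[p]).minimal ℤ_[p]).integralModel ℤ_[p]).c₄ <
      addVal ℤ_[p] (((W.baseChange ℚ_[p]).minimal ℤ_[p]).integralModel ℤ_[p]).Δ)
    {d' : ℤ} (hd'4 : d' % 4 = 1) (hd'sq : Squarefree d') (hgcd : Int.gcd d' (W.conductorNorm ℤ) = 1)
    (hneg : (-1 : ℤ) ^ (p / 2) * p * d' < 0)
    (hodd : ∀ q ∈ M.primeFactors, q ≠ 2 → J((-1 : ℤ) ^ (p / 2) * p * d' | q) = 1)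
    (htwo : 2 ∣ M → ((-1 : ℤ) ^ (p / 2) * p * d') % 8 = 1)
    (hsc : ¬ 12 / Nat.gcd a 12 ∣ p - 1) :
    W.rootNumber * (W.quadraticTwist (((-1 : ℤ) ^ (p / 2) * p * d' : ℤ) : ℚ)).rootNumber = 1 := by
  rw [rootNumber_mul_rootNumber_ramifiedTwist W hmod hF1 hF1' hp5 hN hM hpM hΔ ha hc₄ hj hd'4 hd'sq hgcd hneg hodd htwo]
  have hp' := (Nat.Prime.eq_two_or_odd (Fact.out : p.Prime)).resolve_left (by omega)
  rcases ha with rfl | rfl | rfl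
  · -- `e = 6 ∤ p − 1 ⟹ p ≢ 1 (3)`
    have e6 : 12 / Nat.gcd 2 12 = 6 := by decide
    rw [e6] at hsc
    have h3 : p % 3 ≠ 1 := fun h ↦ hsc (by omega)
    simp [h3]
  · -- `e = 4 ∤ p − 1 ⟹ p ≡ 3 (4)`
    have e4 : 12 / Nat.gcd 3 12 = 4 := by decide
    rw [e4] at hsc
    have h4 : p % 4 = 3 := by omega
    simp [ZMod.χ₄_nat_three_mod_four h4]
  · -- `e = 3 ∤ p − 1 ⟹ p ≢ 1 (3)`
    have e3 : 12 / Nat.gcd 4 12 = 3 := by decide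
    rw [e3] at hsc
    have h3 : p % 3 ≠ 1 := fun h ↦ hsc (by omega)
    simp [h3]

/-- **PRINCIPAL-SERIES HALF (`e ∣ p − 1` ⟹ sign `−1`)**, same data (POTENTIALLY GOOD — the hypothesis the sketch's
`SignLawPrincipalSeries` lacks at potentially multiplicative `p`): if `e ∣ p − 1` then `w(E)·w(E^{(d)}) = −1`.
[cite: Rohrlich1993Compositio, Prop. 2(iv)] [cite: KellockDokchitser2023, Rem. 2.2] -/
theorem rootNumber_mul_rootNumber_ramifiedTwist_eq_neg_one_of_dvd (W : WeierstrassCurve ℚ) [W.IsElliptic]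
    (hmod : exists_isNewformOf) (hF1 : W.atkinLehnerEigenvalueAt_eq_localRootNumberAt)
    (hF1' : (W.quadraticTwist (((-1 : ℤ) ^ (p / 2) * p : ℤ) : ℚ)).atkinLehnerEigenvalueAt_eq_localRootNumberAt)
    (hp5 : 5 ≤ p) {M : ℕ} (hN : W.conductorNorm ℤ = M * p ^ 2) (hM : Squarefree M) (hpM : ¬ p ∣ M) {a : ℕ}
    (hΔ : addVal ℤ_[p] (((W.baseChange ℚ_[p]).minimal ℤ_[p]).integralModel ℤ_[p]).Δ = a)
    (ha : a = 2 ∨ a = 3 ∨ a = 4)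
    (hc₄ : addVal ℤ_[p] (((W.baseChange ℚ_[p]).minimal ℤ_[p]).integralModel ℤ_[p]).c₄ ≠ 0)
    (hj : ¬ 3 * addVal ℤ_[p] (((W.baseChange ℚ_[p]).minimal ℤ_[p]).integralModel ℤ_[p]).c₄ <
      addVal ℤ_[p] (((W.baseChange ℚ_[p]).minimal ℤ_[p]).integralModel ℤ_[p]).Δ)
    {d' : ℤ} (hd'4 : d' % 4 = 1) (hd'sq : Squarefree d') (hgcd : Int.gcd d' (W.conductorNorm ℤ) = 1)
    (hneg : (-1 : ℤ) ^ (p / 2) * p * d' < 0)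
    (hodd : ∀ q ∈ M.primeFactors, q ≠ 2 → J((-1 : ℤ) ^ (p / 2) * p * d' | q) = 1)
    (htwo : 2 ∣ M → ((-1 : ℤ) ^ (p / 2) * p * d') % 8 = 1)
    (hps : 12 / Nat.gcd a 12 ∣ p - 1) :
    W.rootNumber * (W.quadraticTwist (((-1 : ℤ) ^ (p / 2) * p * d' : ℤ) : ℚ)).rootNumber = -1 := by
  rw [rootNumber_mul_rootNumber_ramifiedTwist W hmod hF1 hF1' hp5 hN hM hpM hΔ ha hc₄ hj hd'4 hd'sq hgcd hneg hodd htwo]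
  have hp' := (Nat.Prime.eq_two_or_odd (Fact.out : p.Prime)).resolve_left (by omega)
  rcases ha with rfl | rfl | rfl
  · have e6 : 12 / Nat.gcd 2 12 = 6 := by decide
    rw [e6] at hps
    have h3 : p % 3 = 1 := by omega
    simp [h3]
  · have e4 : 12 / Nat.gcd 3 12 = 4 := by decide
    rw [e4] at hps
    have h4 : p % 4 = 1 := by omega
    simp [ZMod.χ₄_nat_one_mod_four h4]
  · have e3 : 12 / Nat.gcd 4 12 = 3 := by decide
    rw [e3] at hps
    have h3 : p % 3 = 1 := by omega
    simp [h3]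

end SignLaw

end Summit.BirchSwinnertonDyer.BirchSwinnertonDyer.Theorems.AdditiveKoly.RamifiedHabitat

end
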